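import Literature.AlgebraicGeometry.Resolution.HironakaDirectrixLinear
import Literature.AlgebraicGeometry.Resolution.RegularSystemOfParameters
import Literature.AlgebraicGeometry.Resolution.RegularLocalRingsNormal
import HarnessLib

/-!
# `τ(x)` does not depend on the regular system of parameters (CoP1, proof of Prop. 4.2)

Topic: `Literature/AlgebraicGeometry/Resolution`. [CoP1] = Cossart–Piltant, J. Algebra 320
(2008), proof of Prop. 4.2 (p. 7) computes the tangent cone, the directrix and `τ(x)` in
`gr_𝔪(R) = k(x)[Y_1, Y_2, Y_3]`, "where `(y_1, y_2, y_3)` is a r.s.p. of `R` and `Y_i` denotes the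
image of `y_i` in `𝔪/𝔪²`". PROVED here: for two regular systems of parameters `c, c'` of a
regular local ring `R` (both minimal generating systems of `𝔪`), writing `c_j = Σ_l a_{jl} c'_l`
and `c'_j = Σ_l b_{jl} c_l`, the reductions `ā, b̄` are mutually inverse matrices over `k` and the
spaces of initial forms correspond under the linear substitution `Y ↦ āY`:

* `exists_matrix_rsop_eq` — the transition matrix `a` (`c_j = Σ_l a_{jl} c'_l`);
* `map_residue_transition_mul_eq_one` — `ā b̄ = 1` (a linear form in an r.s.p. vanishing in
  `𝔪²` has coefficients in `𝔪`, Matsumura Thm. 17.10);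
* `linSubst_image_initialForms_subset`, `initialForms_eq_image_linSubst` —
  **`cl_μ^{c'}(J) = σ_ā(cl_μ^{c}(J))`**;
* `hironakaTauAt_eq_of_rsop` — **`τ` computed from `c` equals `τ` computed from `c'`**
  (`hironakaTau_image_linSubst`, `HironakaDirectrixLinear.lean`).

## Sources

* V. Cossart, O. Piltant, J. Algebra 320 (2008), proof of Prop. 4.2, p. 7. [CossartPiltant2008]
* H. Matsumura, *Commutative Ring Theory*, Thm. 17.10 (`gr_𝔪(R) = k[Y]`). [Matsumura1987]
-/

noncomputable section

open MvPolynomial IsLocalRing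

namespace Literature.AlgebraicGeometry.Resolution

universe u

section Transition

variable {R : Type u} [CommRing R] {d : ℕ} (c c' : Fin d → R)

/-- **Transition matrix between two generating systems of the same ideal**: if `(c) ⊆ (c')`
then `c_j = Σ_l a_{jl} c'_l` for some matrix `a`. [folklore] -/
theorem exists_matrix_rsop_eq (h : Ideal.span (Set.range c) ≤ Ideal.span (Set.range c')) :
    ∃ a : Matrix (Fin d) (Fin d) R, ∀ j, c j = ∑ l, a j l * c' l := by
  have : ∀ j, ∃ f : Fin d → R, ∑ l, f l * c' l = c j := fun j =>
    Ideal.mem_span_range_iff_exists_fun.mp (h (Ideal.subset_span ⟨j, rfl⟩))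
  choose f hf using this
  exact ⟨Matrix.of f, fun j => (hf j).symm⟩

variable {c c'}

/-- A linear substitution keeps forms of degree `μ` forms of degree `μ`. [folklore] -/
theorem isHomogeneous_linSubst (a : Matrix (Fin d) (Fin d) R) {F : MvPolynomial (Fin d) R} {μ : ℕ}
    (hF : F.IsHomogeneous μ) : (linSubst R a F).IsHomogeneous μ := by
  have h := hF.eval₂ (C : R →+* MvPolynomial (Fin d) R) (fun j => ∑ l, C (a j l) * X l)
    (fun r => isHomogeneous_C _ r) (fun j => IsHomogeneous.sum _ _ _ fun l _ =>
      (isHomogeneous_X R l).C_mul (a j l))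
  rw [one_mul] at h
  exact h

/-- Substituting the transition expressions: `(σ_a F)(c') = F(c)` when `c_j = Σ_l a_{jl} c'_l`.
[folklore] -/
theorem eval_linSubst_of_transition {a : Matrix (Fin d) (Fin d) R} (ha : ∀ j, c j = ∑ l, a j l * c' l)
    (F : MvPolynomial (Fin d) R) : eval c' (linSubst R a F) = eval c F := by
  have : (eval c').comp (linSubst R a).toRingHom = eval c := by
    refine MvPolynomial.ringHom_ext (fun r => ?_) (fun j => ?_)
    · rw [RingHom.comp_apply, AlgHom.toRingHom_eq_coe, AlgHom.coe_toRingHom, MvPolynomial.algHom_C,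
        MvPolynomial.algebraMap_eq, eval_C, eval_C]
    · rw [RingHom.comp_apply, AlgHom.toRingHom_eq_coe, AlgHom.coe_toRingHom, linSubst_X, map_sum,
        eval_X, ha j]
      exact Finset.sum_congr rfl fun l _ => by rw [map_mul, eval_C, eval_X]
  exact RingHom.congr_fun this F

/-- Reduction modulo `𝔪` commutes with the substitution: `σ_a F ↦ σ_ā F̄`. [folklore] -/
theorem map_linSubst {S : Type u} [CommRing S] (f : R →+* S) (a : Matrix (Fin d) (Fin d) R)
    (F : MvPolynomial (Fin d) R) :
    MvPolynomial.map f (linSubst R a F) = linSubst S (a.map f) (MvPolynomial.map f F) := by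
  have : (MvPolynomial.map f).comp (linSubst R a).toRingHom =
      (linSubst S (a.map f)).toRingHom.comp (MvPolynomial.map f) := by
    refine MvPolynomial.ringHom_ext (fun r => ?_) (fun j => ?_)
    · simp only [RingHom.comp_apply, AlgHom.toRingHom_eq_coe, AlgHom.coe_toRingHom,
        MvPolynomial.algHom_C, MvPolynomial.algebraMap_eq, map_C]
    · rw [RingHom.comp_apply, RingHom.comp_apply, AlgHom.toRingHom_eq_coe, AlgHom.coe_toRingHom,
        AlgHom.toRingHom_eq_coe, AlgHom.coe_toRingHom, linSubst_X, map_X, linSubst_X, map_sum]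
      exact Finset.sum_congr rfl fun l _ => by rw [map_mul, map_C, map_X, Matrix.map_apply]
  exact RingHom.congr_fun this F

end Transition

section Regular

variable {R : Type u} [CommRing R] [IsRegularLocalRing R] {d : ℕ}
  (hd : (maximalIdeal R).spanFinrank = d) {c c' : Fin d → R}
  (hc : Ideal.span (Set.range c) = maximalIdeal R) (hc' : Ideal.span (Set.range c') = maximalIdeal R)

/-- **`σ_ā(cl_μ^{c}(J)) ⊆ cl_μ^{c'}(J)`**: if `F̄` is the initial form (w.r.t. `c`) of `F(c) ∈ J`,
then `σ_ā F̄` is the reduction of the form `σ_a F` with `(σ_a F)(c') = F(c) ∈ J`.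
[cite: CossartPiltant2008, proof of Prop. 4.2] -/
theorem linSubst_image_initialForms_subset {a : Matrix (Fin d) (Fin d) R}
    (ha : ∀ j, c j = ∑ l, a j l * c' l) (J : Ideal R) (μ : ℕ) :
    linSubst (ResidueField R) (a.map (residue R)) '' (initialForms c J μ : Set _) ⊆
      initialForms c' J μ := by
  rintro _ ⟨G, ⟨F, hF, hFJ, rfl⟩, rfl⟩
  refine ⟨linSubst R a F, isHomogeneous_linSubst a hF, ?_, ?_⟩
  · rw [eval_linSubst_of_transition ha]
    exact hFJ
  · exact map_linSubst (residue R) a F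

include hd hc in
/-- **`ā b̄ = 1`** for the transition matrices between two regular systems of parameters
(`c = a c'`, `c' = b c`): `Σ_m ((ab)_{jm} − δ_{jm}) c_m = 0 ∈ 𝔪²`, and a linear form in a
regular system of parameters with value in `𝔪²` has all its coefficients in `𝔪` (Matsumura
Thm. 17.10). [cite: Matsumura1987, Thm. 17.10] -/
theorem map_residue_transition_mul_eq_one {a b : Matrix (Fin d) (Fin d) R}
    (ha : ∀ j, c j = ∑ l, a j l * c' l) (hb : ∀ j, c' j = ∑ l, b j l * c l) :
    a.map (residue R) * b.map (residue R) = 1 := by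
  rw [← Matrix.map_mul]
  ext j m
  -- the linear form `Σ_m ((ab)_{jm} − δ_{jm}) Y_m` vanishes at `c`
  have h1 : ∑ m', (a * b) j m' * c m' = c j := by
    simp only [Matrix.mul_apply, Finset.sum_mul]
    rw [Finset.sum_comm, ha j]
    refine Finset.sum_congr rfl fun l _ => ?_
    rw [hb l, Finset.mul_sum]
    exact Finset.sum_congr rfl fun m' _ => by ring
  have h2 : ∑ m', (1 : Matrix (Fin d) (Fin d) R) j m' * c m' = c j := by
    rw [Finset.sum_eq_single j, Matrix.one_apply_eq, one_mul]
    · intro m' _ hm'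
      rw [Matrix.one_apply_ne (Ne.symm hm'), zero_mul]
    · exact fun h => (h (Finset.mem_univ j)).elim
  have hsum : ∑ m', ((a * b) j m' - (1 : Matrix (Fin d) (Fin d) R) j m') * c m' = 0 := by
    simp only [sub_mul, Finset.sum_sub_distrib, h1, h2, sub_self]
  set F : MvPolynomial (Fin d) R := ∑ m', C ((a * b) j m' - (1 : Matrix (Fin d) (Fin d) R) j m') * X m'
    with hFdef
  have hF : F.IsHomogeneous 1 :=
    IsHomogeneous.sum _ _ _ fun m' _ => (isHomogeneous_X R m').C_mul _
  have hFc : eval c F ∈ maximalIdeal R ^ (1 + 1) := by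
    have : eval c F = 0 := by
      rw [hFdef, map_sum]
      simp only [map_mul, eval_C, eval_X]
      exact hsum
    rw [this]
    exact zero_mem _
  have hcoeff := coeff_mem_maximalIdeal_of_eval_mem_pow hd c hc hF hFc (Finsupp.single m 1)
  have hcm : F.coeff (Finsupp.single m 1) = (a * b) j m - (1 : Matrix (Fin d) (Fin d) R) j m := by
    classical
    rw [hFdef, coeff_sum, Finset.sum_eq_single m]
    · rw [coeff_C_mul, coeff_X, if_pos rfl, mul_one]
    · intro m' _ hm'
      rw [coeff_C_mul, coeff_X, if_neg (fun h => hm' (Finsupp.single_left_injective one_ne_zero h)),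
        mul_zero]
    · exact fun h => (h (Finset.mem_univ m)).elim
  rw [hcm, ← residue_eq_zero_iff, map_sub, sub_eq_zero] at hcoeff
  rw [Matrix.map_apply, hcoeff, Matrix.one_apply, Matrix.one_apply]
  split_ifs
  · exact map_one _
  · exact map_zero _

include hd hc' in
/-- **`cl_μ^{c'}(J) = σ_ā(cl_μ^{c}(J))`**: the spaces of initial forms with respect to two
regular systems of parameters correspond under the invertible linear substitution `Y ↦ āY`.
[cite: CossartPiltant2008, proof of Prop. 4.2] -/
theorem initialForms_eq_image_linSubst {a b : Matrix (Fin d) (Fin d) R}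
    (ha : ∀ j, c j = ∑ l, a j l * c' l) (hb : ∀ j, c' j = ∑ l, b j l * c l) (J : Ideal R) (μ : ℕ) :
    (initialForms c' J μ : Set (MvPolynomial (Fin d) (ResidueField R))) =
      linSubst (ResidueField R) (a.map (residue R)) '' (initialForms c J μ : Set _) := by
  have hba : b.map (residue R) * a.map (residue R) = 1 :=
    map_residue_transition_mul_eq_one hd hc' hb ha
  apply Set.Subset.antisymm
  · intro G hG
    refine ⟨linSubst (ResidueField R) (b.map (residue R)) G,
      linSubst_image_initialForms_subset hb J μ ⟨G, hG, rfl⟩, ?_⟩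
    rw [← AlgHom.comp_apply, ← linSubst_mul, hba, linSubst_one, AlgHom.id_apply]
  · exact linSubst_image_initialForms_subset ha J μ

include hd hc hc' in
/-- **`τ` does not depend on the regular system of parameters**: `τ` of `cl_μ(J)` computed with
`c'` equals that computed with `c` ([CoP1]'s `τ(x)` is well defined).
[cite: CossartPiltant2008, proof of Prop. 4.2] -/
theorem hironakaTauAt_eq_of_rsop (J : Ideal R) (μ : ℕ) :
    hironakaTauAt c' J μ = hironakaTauAt c J μ := by
  obtain ⟨a, ha⟩ := exists_matrix_rsop_eq c c' (by rw [hc, hc'])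
  obtain ⟨b, hb⟩ := exists_matrix_rsop_eq c' c (by rw [hc, hc'])
  have hab := map_residue_transition_mul_eq_one hd hc ha hb
  have hba := map_residue_transition_mul_eq_one hd hc' hb ha
  rw [hironakaTauAt, hironakaTauAt, initialForms_eq_image_linSubst hd hc' ha hb J μ]
  exact hironakaTau_image_linSubst _ hab hba _

end Regular

end Literature.AlgebraicGeometry.Resolution

end
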